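import Literature.Geometry.Manifold.InverseFunctionTheorem
import Mathlib.Analysis.InnerProductSpace.PiL2
import Mathlib.Geometry.Manifold.Instances.Real
import Mathlib.Geometry.Manifold.Algebra.LieGroup
import Mathlib.Geometry.Manifold.Algebra.SMul
import HarnessLib

/-!
# Charts of the maximal atlas from coordinate functions (inverse function theorem)

Topic `Geometry/Manifold`; namespace `Literature.Geometry.Manifold`. Two standard consequences of
the inverse function theorem for a `C^∞` manifold `M` modelled on a complete normed space `E`
itself (`𝓘(ℝ, E)`, e.g. `𝓡 d`):

* `exists_mem_maximalAtlas_eqOn` — **a smooth map to the model space with invertible differential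
  is a chart**: if `F : M → E` is `C^∞` on an open `U ∋ x₀` and the derivative of its expression in
  the chart at `x₀` is invertible at `x₀`, then there is a chart `ψ` of the maximal `C^∞` atlas with
  `x₀ ∈ ψ.source ⊆ U` and `ψ = F` on `ψ.source` (Lee, *Introduction to Smooth Manifolds*, 2nd ed.,
  Thm. 4.5 with Prop. 5.16/Example 1.4: smooth coordinate maps are exactly the local
  diffeomorphisms onto open subsets of the model space);
* `exists_mem_maximalAtlas_apply_zero_eq` — **completing one function to a chart**: for
  `E = EuclideanSpace ℝ (Fin (d + 1))` and a real function `f`, `C^∞` on an open `U ∋ x₀`, whose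
  differential at `x₀` is nonzero, there is a chart `ψ` of the maximal atlas about `x₀`, with
  source in `U`, whose FIRST coordinate is `f`: `(ψ x) 0 = f x` on `ψ.source` (Lee, Thm. 5.12 /
  the "slice chart" for the regular level sets of `f`). Proof: in the chart `φ` at `x₀` some
  partial derivative `∂ᵢ(f ∘ φ⁻¹)` is nonzero; replacing the `i`-th coordinate of `φ` by `f` gives
  a map with invertible differential, and a coordinate permutation moves it to position `0`.

The chart is assembled as `φ ≫ₕ D` with `φ` the chart at `x₀` and `D` the partial homeomorphism of
`E` given by Mathlib's inverse function theorem (`ContDiffAt.toOpenPartialHomeomorph`), restricted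
to where the derivative stays invertible so that its inverse is `C^∞`
(`contDiffOn_symm_of_forall_hasFDerivAt_equiv`, `InverseFunctionTheorem.lean`); membership in
the maximal atlas is `IsManifold.mem_maximalAtlas_iff_contMDiffOn`. These charts are the slice /
wave coordinates consumed by the Cauchy-problem files of `Geometry/Lorentzian` (level sets of a
time function as coordinate hyperplanes; harmonic coordinates built from solutions of the wave
equation). Everything is proved; no definitions, no named facts.

## References

* J. M. Lee, *Introduction to Smooth Manifolds*, 2nd ed., GTM 218, Springer 2013, Thm. 4.5,
  Example 1.4 / Prop. 5.16, Thm. 5.12. [LeeSmoothManifolds2013]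
-/

noncomputable section

open Set Filter Function Manifold
open scoped Manifold ContDiff Topology

namespace Literature.Geometry.Manifold

section General

variable {E : Type*} [NormedAddCommGroup E] [NormedSpace ℝ E] [CompleteSpace E]
  {M : Type*} [TopologicalSpace M] [ChartedSpace E M] [IsManifold 𝓘(ℝ, E) ∞ M]

omit [CompleteSpace E] in
/-- A chart of the maximal `C^∞` atlas of a manifold modelled on `E` itself, followed by a partial
homeomorphism of `E` which is smooth with smooth inverse, is again in the maximal atlas (a copy of
`Literature.Topology.FourManifolds.trans_mem_maximalAtlas_of_contDiffOn`, to keep the imports of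
this general file light). [folklore] -/
private theorem trans_mem_maximalAtlas_of_contDiffOn' {e : OpenPartialHomeomorph M E}
    (he : e ∈ IsManifold.maximalAtlas 𝓘(ℝ, E) ∞ M) (D : OpenPartialHomeomorph E E)
    (hD : ContDiffOn ℝ ∞ D D.source) (hD' : ContDiffOn ℝ ∞ D.symm D.target) :
    e ≫ₕ D ∈ IsManifold.maximalAtlas 𝓘(ℝ, E) ∞ M := by
  rw [IsManifold.mem_maximalAtlas_iff_contMDiffOn, OpenPartialHomeomorph.coe_trans,
    OpenPartialHomeomorph.coe_trans_symm, OpenPartialHomeomorph.trans_source,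
    OpenPartialHomeomorph.trans_target]
  constructor
  · exact (contMDiffOn_iff_contDiffOn.2 hD).comp
      ((contMDiffOn_of_mem_maximalAtlas he).mono inter_subset_left) fun x hx => hx.2
  · exact (contMDiffOn_symm_of_mem_maximalAtlas he).comp
      ((contMDiffOn_iff_contDiffOn.2 hD').mono inter_subset_left) fun x hx => hx.2

/-- **A smooth map to the model space with invertible differential is a chart of the maximal
atlas** (Lee 2013, Thm. 4.5 with Example 1.4 / Prop. 5.16). Let `M` be a `C^∞` manifold modelled
on the complete normed space `E`, `F : M → E` of class `C^∞` on an open set `U ∋ x₀`, and suppose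
the derivative at `φ x₀` of the chart expression `F ∘ φ⁻¹` (`φ = chartAt E x₀`) is a continuous
linear equivalence. Then there is `ψ ∈ maximalAtlas` with `x₀ ∈ ψ.source ⊆ U` and `ψ x = F x` for
all `x ∈ ψ.source`. [cite: LeeSmoothManifolds2013, Thm. 4.5 and Example 1.4] -/
theorem exists_mem_maximalAtlas_eqOn {F : M → E} {U : Set M} (hU : IsOpen U)
    (hF : ContMDiffOn 𝓘(ℝ, E) 𝓘(ℝ, E) ∞ F U) {x₀ : M} (hx₀ : x₀ ∈ U) (F' : E ≃L[ℝ] E)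
    (hF' : HasFDerivAt (F ∘ (chartAt E x₀).symm) (F' : E →L[ℝ] E) (chartAt E x₀ x₀)) :
    ∃ ψ ∈ IsManifold.maximalAtlas 𝓘(ℝ, E) ∞ M, x₀ ∈ ψ.source ∧ ψ.source ⊆ U ∧
      ∀ x ∈ ψ.source, ψ x = F x := by
  set φ := chartAt E x₀ with hφ
  have hφatlas : φ ∈ IsManifold.maximalAtlas 𝓘(ℝ, E) ∞ M := IsManifold.chart_mem_maximalAtlas x₀
  have hx₀φ : x₀ ∈ φ.source := mem_chart_source E x₀
  -- the chart expression `f = F ∘ φ⁻¹` on `O = φ(φ.source ∩ U)`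
  set O : Set E := φ.target ∩ φ.symm ⁻¹' U with hO
  have hOo : IsOpen O := φ.isOpen_inter_preimage_symm hU
  set f : E → E := F ∘ φ.symm with hf
  have hfO : ContDiffOn ℝ ∞ f O := by
    have h1 : ContMDiffOn 𝓘(ℝ, E) 𝓘(ℝ, E) ∞ f O :=
      hF.comp ((contMDiffOn_chart_symm (I := 𝓘(ℝ, E)) (n := ∞) (x := x₀)).mono
        inter_subset_left) fun q hq ↦ hq.2
    exact contMDiffOn_iff_contDiffOn.1 h1
  set a : E := φ x₀ with ha
  have haO : a ∈ O := by
    refine ⟨φ.map_source hx₀φ, ?_⟩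
    show φ.symm (φ x₀) ∈ U
    rw [φ.left_inv hx₀φ]
    exact hx₀
  -- shrink `O` to where the derivative of `f` is invertible
  set W : Set E := O ∩ (fderiv ℝ f) ⁻¹' range ((↑) : (E ≃L[ℝ] E) → E →L[ℝ] E) with hW
  have hWo : IsOpen W :=
    (hfO.continuousOn_fderiv_of_isOpen hOo (by simp)).isOpen_inter_preimage hOo
      ContinuousLinearEquiv.isOpen
  have haW : a ∈ W := ⟨haO, ⟨F', hF'.fderiv.symm⟩⟩
  -- the inverse function theorem at `a`, restricted to `W`
  have hfa : ContDiffAt ℝ ∞ f a := hfO.contDiffAt (hOo.mem_nhds haO)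
  have hn : (∞ : ℕ∞ω) ≠ 0 := by simp
  set D₀ := hfa.toOpenPartialHomeomorph f hF' hn with hD₀
  set D := D₀.restrOpen W hWo with hD
  have hDf : ∀ z, D z = f z := fun z ↦ rfl
  have hDsrc : D.source = D₀.source ∩ W := D₀.restrOpen_source W hWo
  have hDW : D.source ⊆ W := by rw [hDsrc]; exact inter_subset_right
  have haD : a ∈ D.source := by
    rw [hDsrc]
    exact ⟨hfa.mem_toOpenPartialHomeomorph_source hF' hn, haW⟩
  have hDs : ContDiffOn ℝ ∞ D D.source :=
    (hfO.mono fun z hz ↦ (hDW hz).1).congr fun z _ ↦ hDf z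
  have hDs' : ContDiffOn ℝ ∞ D.symm D.target := by
    refine contDiffOn_symm_of_forall_hasFDerivAt_equiv D (fun z _ ↦ hDf z) hn
      (fun z hz ↦ hfO.contDiffAt (hOo.mem_nhds (hDW hz).1)) fun z hz ↦ ?_
    obtain ⟨e, he⟩ := (hDW hz).2
    refine ⟨e, ?_⟩
    rw [he]
    exact ((hfO.differentiableOn (by simp) z (hDW hz).1).differentiableAt
      (hOo.mem_nhds (hDW hz).1)).hasFDerivAt
  -- the chart `ψ = D ∘ φ`
  have hsrc : (φ ≫ₕ D).source = φ.source ∩ φ ⁻¹' D.source := OpenPartialHomeomorph.trans_source _ _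
  refine ⟨φ ≫ₕ D, trans_mem_maximalAtlas_of_contDiffOn' hφatlas D hDs hDs', ?_, ?_, ?_⟩
  · rw [hsrc]
    exact ⟨hx₀φ, haD⟩
  · rw [hsrc]
    rintro x ⟨hxφ, hxD⟩
    have h := (hDW hxD).1.2
    simp only [mem_preimage, φ.left_inv hxφ] at h
    exact h
  · rw [hsrc]
    rintro x ⟨hxφ, -⟩
    rw [OpenPartialHomeomorph.coe_trans, comp_apply, hDf]
    simp only [hf, comp_apply, φ.left_inv hxφ]

/-- The same, with the invertibility hypothesis on the manifold differential `mfderiv` (which for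
the model `𝓘(ℝ, E)` is the derivative of the chart expression in the chart at `x₀`).
[cite: LeeSmoothManifolds2013, Thm. 4.5 and Example 1.4] -/
theorem exists_mem_maximalAtlas_eqOn_of_mfderiv {F : M → E} {U : Set M} (hU : IsOpen U)
    (hF : ContMDiffOn 𝓘(ℝ, E) 𝓘(ℝ, E) ∞ F U) {x₀ : M} (hx₀ : x₀ ∈ U) (F' : E ≃L[ℝ] E)
    (hF' : mfderiv 𝓘(ℝ, E) 𝓘(ℝ, E) F x₀ = (F' : E →L[ℝ] E)) :
    ∃ ψ ∈ IsManifold.maximalAtlas 𝓘(ℝ, E) ∞ M, x₀ ∈ ψ.source ∧ ψ.source ⊆ U ∧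
      ∀ x ∈ ψ.source, ψ x = F x := by
  refine exists_mem_maximalAtlas_eqOn hU hF hx₀ F' ?_
  set φ := chartAt E x₀ with hφ
  have hmd : MDifferentiableAt 𝓘(ℝ, E) 𝓘(ℝ, E) F x₀ :=
    (hF.contMDiffAt (hU.mem_nhds hx₀)).mdifferentiableAt (by simp)
  -- `F ∘ φ⁻¹` is differentiable at `φ x₀`
  set O : Set E := φ.target ∩ φ.symm ⁻¹' U with hO
  have hOo : IsOpen O := φ.isOpen_inter_preimage_symm hU
  have haO : φ x₀ ∈ O := by
    refine ⟨φ.map_source (mem_chart_source E x₀), ?_⟩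
    show φ.symm (φ x₀) ∈ U
    rw [φ.left_inv (mem_chart_source E x₀)]
    exact hx₀
  have hfO : ContDiffOn ℝ ∞ (F ∘ φ.symm) O := by
    have h1 : ContMDiffOn 𝓘(ℝ, E) 𝓘(ℝ, E) ∞ (F ∘ φ.symm) O :=
      hF.comp ((contMDiffOn_chart_symm (I := 𝓘(ℝ, E)) (n := ∞) (x := x₀)).mono
        inter_subset_left) fun q hq ↦ hq.2
    exact contMDiffOn_iff_contDiffOn.1 h1
  have hd : DifferentiableAt ℝ (F ∘ φ.symm) (φ x₀) :=
    (hfO.differentiableOn (by simp) _ haO).differentiableAt (hOo.mem_nhds haO)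
  have h1 : mfderiv 𝓘(ℝ, E) 𝓘(ℝ, E) F x₀ =
      fderivWithin ℝ (writtenInExtChartAt 𝓘(ℝ, E) 𝓘(ℝ, E) x₀ F) (range 𝓘(ℝ, E))
        (extChartAt 𝓘(ℝ, E) x₀ x₀) := hmd.mfderiv
  rw [ModelWithCorners.Boundaryless.range_eq_univ, fderivWithin_univ] at h1
  have h2 : fderiv ℝ (F ∘ φ.symm) (φ x₀) = (F' : E →L[ℝ] E) := by
    rw [← hF', h1]
    rfl
  rw [← h2]
  exact hd.hasFDerivAt

end General

/-! ### Completing one function to a chart of `EuclideanSpace ℝ (Fin (d + 1))` -/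

section Euclidean

variable {d : ℕ} {M : Type*} [TopologicalSpace M] [ChartedSpace (EuclideanSpace ℝ (Fin (d + 1))) M]
  [IsManifold (𝓡 (d + 1)) ∞ M]

/-- The linear map `v ↦ v + (ℓ v - v i) • eᵢ` of `ℝ^{d+1}` (replace the `i`-th coordinate by
`ℓ v`) is injective when `ℓ eᵢ ≠ 0`. [folklore] -/
theorem injective_replaceCoord (ℓ : EuclideanSpace ℝ (Fin (d + 1)) →L[ℝ] ℝ) (i : Fin (d + 1))
    (hi : ℓ (EuclideanSpace.single i 1) ≠ 0) :
    Function.Injective (fun v : EuclideanSpace ℝ (Fin (d + 1)) ↦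
      v + (ℓ v - v i) • EuclideanSpace.single i (1 : ℝ)) := by
  set T : EuclideanSpace ℝ (Fin (d + 1)) →ₗ[ℝ] EuclideanSpace ℝ (Fin (d + 1)) :=
    LinearMap.id + (ℓ.toLinearMap - (EuclideanSpace.proj i).toLinearMap).smulRight
      (EuclideanSpace.single i (1 : ℝ)) with hT
  have hTapply : ∀ v, T v = v + (ℓ v - v i) • EuclideanSpace.single i (1 : ℝ) := fun v ↦ by
    simp [hT]
  suffices h : Function.Injective T by
    intro v w hvw
    exact h (by rw [hTapply, hTapply]; exact hvw)
  rw [← LinearMap.ker_eq_bot, LinearMap.ker_eq_bot']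
  intro v hv
  rw [hTapply] at hv
  -- coordinates `j ≠ i` of `v` vanish
  have hj : ∀ j, j ≠ i → v j = 0 := fun j hj ↦ by
    have h := congrArg (fun w : EuclideanSpace ℝ (Fin (d + 1)) ↦ w j) hv
    simpa [PiLp.single_apply, hj] using h
  -- so `v = v i • eᵢ` and `ℓ v = v i * ℓ eᵢ = 0`
  have hvi : v = v i • EuclideanSpace.single i (1 : ℝ) := by
    ext j
    by_cases h : j = i
    · subst h; simp
    · simp [h, hj j h]
  have hℓ : ℓ v = v i * ℓ (EuclideanSpace.single i 1) := by
    conv_lhs => rw [hvi]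
    simp
  have hi' : v i = 0 := by
    have h := congrArg (fun w : EuclideanSpace ℝ (Fin (d + 1)) ↦ w i) hv
    simp [hℓ] at h
    rcases h with h | h
    · exact h
    · exact absurd h hi
  rw [hvi, hi', zero_smul]

/-- **Completing a function with nonzero differential to a chart.** Let `M` be a `C^∞` manifold
modelled on `ℝ^{d+1} = EuclideanSpace ℝ (Fin (d + 1))`, `f : M → ℝ` of class `C^∞` on an open set
`U ∋ x₀`, and suppose the derivative of the chart expression `f ∘ φ⁻¹` (`φ = chartAt _ x₀`) at
`φ x₀` is nonzero. Then there is a chart `ψ` of the maximal `C^∞` atlas with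
`x₀ ∈ ψ.source ⊆ U` whose first coordinate is `f`: `(ψ x) 0 = f x` for all `x ∈ ψ.source`
(Lee 2013, Thm. 5.12, slice charts for regular level sets; here: some `∂ᵢ(f ∘ φ⁻¹) ≠ 0`, replace
the `i`-th coordinate by `f` and swap it to position `0`, then `exists_mem_maximalAtlas_eqOn`).
[cite: LeeSmoothManifolds2013, Thm. 5.12] -/
theorem exists_mem_maximalAtlas_apply_zero_eq {f : M → ℝ} {U : Set M} (hU : IsOpen U)
    (hf : ContMDiffOn (𝓡 (d + 1)) 𝓘(ℝ, ℝ) ∞ f U) {x₀ : M} (hx₀ : x₀ ∈ U)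
    (ℓ : EuclideanSpace ℝ (Fin (d + 1)) →L[ℝ] ℝ) (hℓ : ℓ ≠ 0)
    (hfℓ : HasFDerivAt (f ∘ (chartAt (EuclideanSpace ℝ (Fin (d + 1))) x₀).symm) ℓ
      (chartAt (EuclideanSpace ℝ (Fin (d + 1))) x₀ x₀)) :
    ∃ ψ ∈ IsManifold.maximalAtlas (𝓡 (d + 1)) ∞ M, x₀ ∈ ψ.source ∧ ψ.source ⊆ U ∧
      ∀ x ∈ ψ.source, ψ x 0 = f x := by
  set Ed := EuclideanSpace ℝ (Fin (d + 1))
  set φ := chartAt Ed x₀ with hφ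
  have hx₀φ : x₀ ∈ φ.source := mem_chart_source Ed x₀
  -- an index with `ℓ eᵢ ≠ 0`
  obtain ⟨i, hi⟩ : ∃ i, ℓ (EuclideanSpace.single i 1) ≠ 0 := by
    by_contra h
    push Not at h
    refine hℓ (ContinuousLinearMap.coe_injective ((EuclideanSpace.basisFun (Fin (d + 1)) ℝ).toBasis.ext
      fun j ↦ ?_))
    simp only [OrthonormalBasis.coe_toBasis, EuclideanSpace.basisFun_apply,
      ContinuousLinearMap.coe_coe, zero_apply]
    exact h j
  -- the coordinate permutation `0 ↔ i` (a linear isometry)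
  set σ₀ : Ed ≃ₗᵢ[ℝ] Ed := LinearIsometryEquiv.piLpCongrLeft 2 ℝ ℝ (Equiv.swap (0 : Fin (d + 1)) i)
    with hσ₀
  have hσapply : ∀ (v : Ed) (j : Fin (d + 1)), σ₀ v j = v (Equiv.swap (0 : Fin (d + 1)) i j) :=
    fun v j ↦ rfl
  set σ : Ed →L[ℝ] Ed := (σ₀.toContinuousLinearEquiv : Ed →L[ℝ] Ed) with hσ
  have hσσ₀ : ∀ v, σ v = σ₀ v := fun v ↦ rfl
  -- the map `G x = φ x + (f x - (φ x) i) • eᵢ` and `F = σ ∘ G`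
  set ei : Ed := EuclideanSpace.single i (1 : ℝ) with hei
  set G : M → Ed := fun x ↦ (φ x : Ed) + (f x - (φ x : Ed) i) • ei with hG
  set F : M → Ed := fun x ↦ σ (G x) with hF
  -- smoothness on `U ∩ φ.source`
  have hUo : IsOpen (U ∩ φ.source) := hU.inter φ.open_source
  have hφs : ContMDiffOn (𝓡 (d + 1)) 𝓘(ℝ, Ed) ∞ (fun x ↦ (φ x : Ed)) (U ∩ φ.source) :=
    (contMDiffOn_chart (I := 𝓡 (d + 1)) (n := ∞) (x := x₀)).mono inter_subset_right
  have hGi : ContMDiffOn (𝓡 (d + 1)) 𝓘(ℝ, ℝ) ∞ (fun x ↦ (φ x : Ed) i) (U ∩ φ.source) :=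
    (EuclideanSpace.proj (𝕜 := ℝ) i).contMDiff.comp_contMDiffOn hφs
  have hf' : ContMDiffOn (𝓡 (d + 1)) 𝓘(ℝ, ℝ) ∞ f (U ∩ φ.source) := hf.mono inter_subset_left
  have hcoef : ContMDiffOn (𝓡 (d + 1)) 𝓘(ℝ, ℝ) ∞ (fun x ↦ f x - (φ x : Ed) i) (U ∩ φ.source) :=
    hf'.sub hGi
  have hGs : ContMDiffOn (𝓡 (d + 1)) 𝓘(ℝ, Ed) ∞ G (U ∩ φ.source) :=
    hφs.add (hcoef.smul contMDiffOn_const)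
  have hFs : ContMDiffOn (𝓡 (d + 1)) (𝓡 (d + 1)) ∞ F (U ∩ φ.source) :=
    σ.contMDiff.comp_contMDiffOn hGs
  -- the derivative of `F ∘ φ⁻¹` at `a = φ x₀`
  set a : Ed := φ x₀ with ha
  set T : Ed →L[ℝ] Ed := ContinuousLinearMap.id ℝ Ed +
    (ℓ - EuclideanSpace.proj i).smulRight ei with hT
  have hTapply : ∀ v, T v = v + (ℓ v - v i) • ei := fun v ↦ rfl
  have hTinj : Function.Injective T := by
    have h := injective_replaceCoord ℓ i hi
    intro v w hvw
    exact h (by simpa only [hTapply] using hvw)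
  set Te : Ed ≃L[ℝ] Ed := (LinearEquiv.ofInjectiveEndo T.toLinearMap hTinj).toContinuousLinearEquiv
    with hTe
  have hTe_coe : (Te : Ed →L[ℝ] Ed) = T := by
    ext v
    rfl
  have hGφ : HasFDerivAt (G ∘ φ.symm) T a := by
    -- near `a`, `G ∘ φ⁻¹ q = q + ((f ∘ φ⁻¹) q - q i) • eᵢ`
    have hev : (fun q : Ed ↦ q + ((f ∘ φ.symm) q - q i) • ei) =ᶠ[𝓝 a] (G ∘ φ.symm) := by
      filter_upwards [φ.open_target.mem_nhds (φ.map_source hx₀φ)] with q hq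
      simp only [hG, comp_apply, φ.right_inv hq]
    have h1 : HasFDerivAt (fun q : Ed ↦ q) (ContinuousLinearMap.id ℝ Ed) a := hasFDerivAt_id a
    have h2 : HasFDerivAt (fun q : Ed ↦ (f ∘ φ.symm) q - q i) (ℓ - EuclideanSpace.proj i) a :=
      hfℓ.sub ((EuclideanSpace.proj (𝕜 := ℝ) i).hasFDerivAt)
    have h3 : HasFDerivAt (fun q : Ed ↦ q + ((f ∘ φ.symm) q - q i) • ei)
        (ContinuousLinearMap.id ℝ Ed + (ℓ - EuclideanSpace.proj i).smulRight ei) a :=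
      h1.add (h2.smul_const ei)
    exact h3.congr_of_eventuallyEq hev.symm
  have hFφ : HasFDerivAt (F ∘ φ.symm) (σ.comp T) a := by
    have h : F ∘ φ.symm = (fun v ↦ σ v) ∘ (G ∘ φ.symm) := rfl
    rw [h]
    exact σ.hasFDerivAt.comp a hGφ
  set F' : Ed ≃L[ℝ] Ed := Te.trans σ₀.toContinuousLinearEquiv with hF'
  have hF'coe : (F' : Ed →L[ℝ] Ed) = σ.comp T := by
    refine ContinuousLinearMap.ext fun v ↦ ?_
    show σ₀.toContinuousLinearEquiv (Te v) = σ (T v)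
    rw [← hTe_coe]
    rfl
  -- apply the general statement
  obtain ⟨ψ, hψ, hx₀ψ, hψU, hψF⟩ := exists_mem_maximalAtlas_eqOn (E := Ed) hUo hFs ⟨hx₀, hx₀φ⟩ F'
    (by rw [hF'coe]; exact hFφ)
  refine ⟨ψ, hψ, hx₀ψ, fun x hx ↦ (hψU hx).1, fun x hx ↦ ?_⟩
  rw [hψF x hx]
  show σ (G x) 0 = f x
  rw [hσσ₀, hσapply, Equiv.swap_apply_left]
  have key : ∀ (v : EuclideanSpace ℝ (Fin (d + 1))) (c : ℝ),
      (v + c • EuclideanSpace.single i (1 : ℝ)) i = v i + c := fun v c ↦ by simp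
  show (G x) i = f x
  simp only [hG, hei]
  rw [key]
  ring

end Euclidean

end Literature.Geometry.Manifold

end
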